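import Literature.NumberTheory.Automorphic.AdelicVectorHeight
import Literature.NumberTheory.GaloisRepresentations.ClosureValuation
import HarnessLib

/-!
# The local heights of `(1, η)` for an ADELIC `η`, and the classical lower bound `h(1, η) ≥ Π_w max(1,|η_w|)^{m_w} · Π_v max(1,|η_v|)`

Topic `NumberTheory/Automorphic`; namespace `Literature.NumberTheory.Automorphic` (sequel of ★ `AdelicVectorHeight`;
companion of ★ `AdelicHeightAffineLineLocal`, which treats RATIONAL `b ∈ K`).  KERNEL only: proved theorems, no definition,
no named fact, no `sorry`.

For a number field `K` and an adele `η ∈ 𝔸_K`, the Godement–Garrett local heights (★ `AdelicVectorHeight`) of the adelic vector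
`![1, η] ∈ 𝔸_K²` are explicit:
* `vecFinHeight_vecCons_one_adele` — `h_v(1, η) = max(1, |η_v|_v)` at every finite place;
* `vecArchNorm_vecCons_one_adele` — `√(1 + |η_w|²)` at an infinite place, `≥ max(1, |η_w|)` (`max_one_le_vecArchNorm_vecCons_one_adele`);
* `hasFiniteMulSupport_max_one_nnnorm_snd` — `max(1,|η_v|_v) = 1` for almost all `v` (an adele is integral almost everywhere), so
  `isHeightFinite_vecCons_one_adele`;
* `classicalHeight_le_vecHeight_vecCons_one_adele` — **`Π_w max(1, |η_w|)^{mult w} · Π_v max(1, |η_v|_v) ≤ h(1, η)`**, whence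
  (`vecHeight_vecCons_one_adele_rpow_neg_le`) `h(1,η)^{−τ} ≤ (Π_w max(1,|η_w|)^{mult w})^{−τ} · (Πᶠ_v max(1,|η_v|_v))^{−τ}` for `τ ≥ 0`.

This is the shape in which the weight `W(η) = h(1, η)^{−N}` of the Fourier-side Eisenstein estimate is split into an archimedean
product and a finite-place product ([Garrett2018, §2.2: `h(x) = Π_v h_v(x)`, `h_v = sup|xᵢ|_v`]; [Weil1965, n° 40–41: the range
`N > 2`]).  Cell `hodgecm-mathlib`, FLOOR 0, E-2 desk, crux item H413, row SW2c-BOUND (E3′) — the ADELIC twist `η = (ξ+β′)·u·ρ_s`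
of the sharp count.  HC_CM is proved only modulo the 7 printed citations until rung 0 closes; this file is unconditional.

## References
* [Garrett2018] P. Garrett, *Modern Analysis of Automorphic Forms by Example* (2018), §2.2 (PDF pp. 81–82).
* [Weil1965] A. Weil, *Sur la formule de Siegel dans la théorie des groupes classiques*, Acta Math. 113 (1965), n° 40–41.
-/

set_option autoImplicit false

noncomputable section

open scoped NNReal Matrix
open NumberField IsDedekindDomain Matrix
open Literature.NumberTheory.GaloisRepresentations (mem_adicCompletionIntegers_iff_norm_le_one)

namespace Literature.NumberTheory.Automorphic

variable (K : Type) [Field K] [NumberField K]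

/-- **`h_v(1, η) = max(1, |η_v|_v)` at a finite place `v`, for an adele `η`.** [cite: Garrett2018, §2.2 (PDF p. 81)] -/
theorem vecFinHeight_vecCons_one_adele (η : AdeleRing (𝓞 K) K) (v : HeightOneSpectrum (𝓞 K)) :
    vecFinHeight K v (![1, η] : Fin 2 → AdeleRing (𝓞 K) K) = max 1 ‖η.2 v‖₊ := by
  refine le_antisymm (vecFinHeight_le fun i => ?_) (max_le ?_ ?_)
  · fin_cases i
    · change ‖((1 : AdeleRing (𝓞 K) K)).2 v‖₊ ≤ _
      rw [show ((1 : AdeleRing (𝓞 K) K)).2 v = 1 from rfl, nnnorm_one]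
      exact le_max_left _ _
    · exact le_max_right _ _
  · have h := nnnorm_snd_apply_le_vecFinHeight v (![1, η] : Fin 2 → AdeleRing (𝓞 K) K) 0
    have h1 : ((![1, η] : Fin 2 → AdeleRing (𝓞 K) K) 0).2 v = 1 := rfl
    rwa [h1, nnnorm_one] at h
  · exact nnnorm_snd_apply_le_vecFinHeight v (![1, η] : Fin 2 → AdeleRing (𝓞 K) K) 1

/-- **The Euclidean norm of `(1, η)` at an infinite place `w` is `√(1 + |η_w|²)`.** [cite: Garrett2018, §2.2 (PDF p. 81)] -/
theorem vecArchNorm_vecCons_one_adele (η : AdeleRing (𝓞 K) K) (w : InfinitePlace K) :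
    vecArchNorm K w (![1, η] : Fin 2 → AdeleRing (𝓞 K) K) = NNReal.sqrt (1 + ‖η.1 w‖₊ ^ 2) := by
  rw [vecArchNorm, Fin.sum_univ_two]
  have h0 : ((![1, η] : Fin 2 → AdeleRing (𝓞 K) K) 0).1 w = 1 := rfl
  have h1 : ((![1, η] : Fin 2 → AdeleRing (𝓞 K) K) 1).1 w = η.1 w := rfl
  rw [h0, h1, nnnorm_one, one_pow]

/-- `max(1, |η_w|) ≤ √(1 + |η_w|²)`. [cite: Garrett2018, §2.2 (PDF p. 81)] -/
theorem max_one_le_vecArchNorm_vecCons_one_adele (η : AdeleRing (𝓞 K) K) (w : InfinitePlace K) :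
    max 1 ‖η.1 w‖₊ ≤ vecArchNorm K w (![1, η] : Fin 2 → AdeleRing (𝓞 K) K) := by
  rw [vecArchNorm_vecCons_one_adele]
  refine max_le ?_ ?_
  · calc (1 : ℝ≥0) = NNReal.sqrt 1 := NNReal.sqrt_one.symm
      _ ≤ _ := NNReal.sqrt_le_sqrt.mpr le_self_add
  · calc ‖η.1 w‖₊ = NNReal.sqrt (‖η.1 w‖₊ ^ 2) := (NNReal.sqrt_sq _).symm
      _ ≤ _ := NNReal.sqrt_le_sqrt.mpr le_add_self

/-- **An adele is integral at almost all finite places**: `max(1, |η_v|_v) = 1` off a finite set of `v`.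
[cite: Garrett2018, §2.2 (PDF p. 82)] -/
theorem hasFiniteMulSupport_max_one_nnnorm_snd (η : AdeleRing (𝓞 K) K) :
    (fun v : HeightOneSpectrum (𝓞 K) => max 1 ‖η.2 v‖₊).HasFiniteMulSupport := by
  have hη : ∀ᶠ v : HeightOneSpectrum (𝓞 K) in Filter.cofinite, η.2 v ∈ v.adicCompletionIntegers K := η.2.2
  refine (Filter.eventually_cofinite.1 hη).subset fun v hv => ?_
  rw [Function.mem_mulSupport] at hv
  intro hmem
  apply hv
  rw [max_eq_left]
  have h := (mem_adicCompletionIntegers_iff_norm_le_one (K := K) (v := v) (η.2 v)).1 hmem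
  exact_mod_cast h

/-- `(1, η)` has finite height data. [cite: Garrett2018, §2.2 (PDF p. 82)] -/
theorem isHeightFinite_vecCons_one_adele (η : AdeleRing (𝓞 K) K) :
    IsHeightFinite K (![1, η] : Fin 2 → AdeleRing (𝓞 K) K) := by
  refine (hasFiniteMulSupport_max_one_nnnorm_snd K η).subset fun v hv => ?_
  rw [Function.mem_mulSupport] at hv ⊢
  rwa [vecFinHeight_vecCons_one_adele] at hv

/-- **Lower bound**: `Π_w max(1, |η_w|)^{mult w} · Πᶠ_v max(1, |η_v|_v) ≤ h(1, η)` for every adele `η`.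
[cite: Garrett2018, §2.2 (PDF p. 81)] -/
theorem classicalHeight_le_vecHeight_vecCons_one_adele (η : AdeleRing (𝓞 K) K) :
    (∏ w : InfinitePlace K, (max 1 ‖η.1 w‖₊) ^ w.mult) *
        ∏ᶠ v : HeightOneSpectrum (𝓞 K), max 1 ‖η.2 v‖₊ ≤
      vecHeight K (![1, η] : Fin 2 → AdeleRing (𝓞 K) K) := by
  rw [vecHeight]
  refine mul_le_mul' (Finset.prod_le_prod' fun w _ => ?_) (le_of_eq (finprod_congr fun v => ?_))
  · exact pow_le_pow_left' (max_one_le_vecArchNorm_vecCons_one_adele K η w) _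
  · exact (vecFinHeight_vecCons_one_adele K η v).symm

/-- `1 ≤ Π_w max(1,|η_w|)^{mult w} · Πᶠ_v max(1,|η_v|_v)`, in particular `1 ≤ h(1, η)`. [cite: Garrett2018, §2.2 (PDF p. 81)] -/
theorem one_le_classicalHeight_adele (η : AdeleRing (𝓞 K) K) :
    (1 : ℝ≥0) ≤ (∏ w : InfinitePlace K, (max 1 ‖η.1 w‖₊) ^ w.mult) *
        ∏ᶠ v : HeightOneSpectrum (𝓞 K), max 1 ‖η.2 v‖₊ := by
  refine one_le_mul (Finset.one_le_prod' fun w _ => one_le_pow_of_one_le' (le_max_left _ _) _) ?_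
  exact one_le_finprod' fun v => le_max_left _ _

/-- **The weight splits**: for `τ ≥ 0`,
`h(1,η)^{−τ} ≤ (Π_w max(1,|η_w|)^{mult w})^{−τ} · (Πᶠ_v max(1,|η_v|_v))^{−τ}`. [cite: Garrett2018, §2.2 (PDF p. 81)] -/
theorem vecHeight_vecCons_one_adele_rpow_neg_le (η : AdeleRing (𝓞 K) K) {τ : ℝ} (hτ : 0 ≤ τ) :
    ((vecHeight K (![1, η] : Fin 2 → AdeleRing (𝓞 K) K) : ℝ≥0) : ℝ) ^ (-τ) ≤
      ((∏ w : InfinitePlace K, (max 1 ‖η.1 w‖₊) ^ w.mult : ℝ≥0) : ℝ) ^ (-τ) *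
        ((∏ᶠ v : HeightOneSpectrum (𝓞 K), max 1 ‖η.2 v‖₊ : ℝ≥0) : ℝ) ^ (-τ) := by
  have hle := classicalHeight_le_vecHeight_vecCons_one_adele K η
  have h1 := one_le_classicalHeight_adele K η
  set A : ℝ≥0 := ∏ w : InfinitePlace K, (max 1 ‖η.1 w‖₊) ^ w.mult
  set B : ℝ≥0 := ∏ᶠ v : HeightOneSpectrum (𝓞 K), max 1 ‖η.2 v‖₊
  have hAB : (0 : ℝ) < (A : ℝ) * (B : ℝ) := by
    have : (1 : ℝ) ≤ (A : ℝ) * (B : ℝ) := by exact_mod_cast h1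
    linarith
  rw [← Real.mul_rpow (NNReal.coe_nonneg _) (NNReal.coe_nonneg _)]
  exact Real.rpow_le_rpow_of_nonpos hAB (by exact_mod_cast hle) (by linarith)

end Literature.NumberTheory.Automorphic
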